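import Summits.QuantumFields.YangMills.Theorems.BalabanUVNodesK0BgProvisoOverRangeLinear
import Literature.MathematicalPhysics.QuantumFieldTheory.Balaban1983to89.Node00.Record12BgRowAnalysis

/-!
# K0‴ ∕ RECORD13 gate ROW P11 — THE CORNER PLAQUETTE: node00-def-P11's named fact `VariationalThm1Scaled F N B₃ a₀ a₁` (the hypothesis `h15` of the
# K0‴ chain) is FALSE for EVERY `B₃` (`N ≥ 2`, `a₀, a₁ > 0`); the faithful `VariationalThm1ScaledSep` forces `B₃ ≥ L²∕2`

Cell `pub-ymgap`, seat `pub-ymgap-dag-n21-c` (g5), `--supports stmt-QuantumFields-19909 --as helper` (K0‴ `Record13Inhabited`, ROW P11).  COUNT-NEUTRAL.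
Answers director-ym LINE №136 («`VariationalThm1Scaled` at non-separated `s` plausibly FALSE») and node00-def-P11 g0's located target (HANDOFF (t3)).

THE WITNESS (no minimiser is computed).  In the tree's — and print's — conventions ([III] (2.2) `Γ₀ = Ω₁ᶜ` = `gammaRegion … 0`; [I] p. 251 «bonds … which
intersect it» = `bondsOf` (≥ 1 endpoint); [6] p. 77 plaquettes = `plaqsOf` (≥ 1 corner), `omegaPlaqs Ω 1 = plaqsOf (Ω 1)`): `k = 1`, `Ω₁ = Λ₁ =` ONE cube of
`𝐃₁` (`M = 1`, `g ≡ 1` so `R₁ = 1`: side `L <` the period `2L^{m+K}`), and the fine plaquette `p` with source `π(−1,−1,0,0)` in the directions `(0,1)`: its far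
corner `π(0) ∈ Ω₁`, so `p ∈ omegaPlaqs Ω 1` carries the scale-1 class bound `dist1 (U₀(∂p)) < B₃δ₁η₁²`, while its FOUR bonds have their sources in `Γ₀`, so the
constraint `M_𝐁(U₀) = W` of ANY admissible `U₀` (`M⁰ = id`) PINS `U₀(∂p) = W₀(∂p)`.  Data: `W₀` = part 2's one-bond configuration at `D ∈ SU(N)` with `dist1 D = t`
(part 4, `N ≥ 2`), all plaquettes `≤ 4t`; `W₁ := 1`.  The fact's OWN existence conjunct hands over a minimiser `U₀`; its regularity conjunct at `n = 1` demands
`t < B₃δ₁η₁²`.  `VariationalThm1Scaled` lets `δ₀, δ₁` vary FREELY per scale: `δ₁ ≪ δ₀` kills it for every `B₃`.  `VariationalThm1ScaledSep`'s separation clause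
constrains `Ω_{n+1}` against `Ω_n` for `1 ≤ n < k` only (vacuous at `k = 1`; nothing separates `Ω₁` from `Γ₀ = Ω₁ᶜ`), and its comparability `δ₀ ≤ 2δ₁`
leaves exactly the room `B₃ < L²∕2`.

WHAT IS PROVED (kernel; [folklore] lattice geometry + bookkeeping; the refuted object is a TREE-TYPED `Prop` — nothing of Bałaban's is asserted or refuted).
§1 `RkOfRecord_at_one`, `cover_zero_mem_cubeEnl_zero`, `cover_notMem_cubeEnl_zero`, `exists_corner_plaq`.  §2 `lt_sitesPerDir_zero`, `exists_seq_singleCube`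
(`Sect2.SeqSeparated` holds), `plaqHol_eq_of_agreeOn` (the four pinned bonds).  §3 ★ `corner_forces` (any thresholds with `4t < δ₀`, `0 < δ₁`, any `ε₀`, `B₃`: the
common conclusion of the two named facts at the corner data implies `t < B₃·δ₁·η₁²`), `eta_one_sq(_le_one)`.  §4 ★★ `not_variationalThm1Scaled`;
`variationalThm1Scaled_degenerate` (`… → a₀ ≤ 0 ∨ a₁ ≤ 0`); ★ `half_sq_L_le_of_variationalThm1ScaledSep` (`… → L²∕2 ≤ B₃`); `not_variationalThm1ScaledSep_of_lt`.

CONSEQUENCES, SAID.  (i) node00-def-K0a's FILE 10 `exists_k0_of_thm1Scaled (h15 : VariationalThm1Scaled F 2 B₃ a₀ a₁) …` has an UNINHABITED hypothesis whenever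
its numerics clauses are satisfiable (they force `a₀, a₁ > 0`): that chain is VACUOUS — №136 (2) «key on `…ScaledSep`, never on `…Scaled`» is now a kernel fact.
(ii) The faithful chain must carry `B₃ ≥ L²∕2` (`≥ 84.5` at `L = 13`): consistent with print's «B₃ depends on d and L only» (the corner plaquette is print's own:
pinned at tolerance `ε₁` by (7) on `Γ₀`, demanded `< B₃ε₁L⁻²` by (8) at `j = 1`), not with a unit numeral.  (iii) The separation-guard decision (№136 (3a)∕(3b))
is untouched: the corner lives at `Γ₀ ∕ Ω₁`, inside every guard on `Ω_{n+1}` vs `Ω_n`, `n ≥ 1`.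
HONEST FRAMING: K0′∕K0‴ neither discharged nor refuted (`Provisos₁₃.bg := BgProvisoΛ` is a different token; only its positive supplier's named fact `…Scaled`
dies, `…ScaledSep` survives with the floor on `B₃`); counts unmoved (typed 28∕28 · discharged 5∕27); one finite `𝕋⁴` torus family; not continuum ∕ OS ∕ mass
gap ∕ Clay.  No `sorry`, `def`, `instance`, `notation`; standard axioms.  DEPENDENCES (by name, CITED not restated): def-P11 `VariationalThm1Scaled(Sep)`,
`Sect2.SeqSeparated` (p494270); def-R `SeqOfRecord ∕ DOfRecord ∕ unionsOfCubes ∕ dCubeSide ∕ cubeEnl ∕ cubeIndices ∕ RkOfRecord ∕ omegaPlaqs`; r11 `Seq ∕ Chain21`,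
`plaqsOf`, `cubeExt`; `B15DeterminingSets.genSet ∕ gammaRegion_zero ∕ pts_zero ∕ bondsOf ∕ AgreeOn ∕ IsMinimizer`; `B15Eq112TorusCover.cover(_eq_cover_iff)`; part 2
`exists_oneBond_cfg ∕ shift_cover ∕ one_lt_sitesPerDir_zero` (p488412), part 4 `exists_su_conj_norm_sub_one_ge` (p491268).
-/


noncomputable section

open scoped Matrix.Norms.L2Operator

namespace Summit.QuantumFields.YangMills.Theorems.K0VariationalThm1ScaledCorner

open Literature.MathematicalPhysics.QuantumFieldTheory.Balaban1983to89
open Literature.MathematicalPhysics.QuantumFieldTheory.Balaban1983to89.Node00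
open Literature.MathematicalPhysics.QuantumFieldTheory.Balaban1983to89.T4Continuum
open B15Eq112TorusCover B14DomainGeom B15DeterminingSets B15LatticeCubeTorus
open Summit.QuantumFields.YangMills.Theorems.K0BgProvisoOverRange (shift_cover one_lt_sitesPerDir_zero exists_oneBond_cfg
  exists_su_conj_norm_sub_one_ge)

/-! ## §1  Geometry: the cube `π([0, s−1]ᵈ)` and its corner plaquette -/
section Geometry

variable {P : Params}

/-- Along the flat history `g ≡ 1` the (2.5) factor is `R = 1` (`log 1 = 0`). [cite: Balaban1988Convergent, (2.5) p.255 (bookkeeping)] -/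
theorem RkOfRecord_at_one (L r : ℕ) : RkOfRecord L r 1 = 1 := by
  unfold RkOfRecord
  have h0 : (Real.log ((1 : ℝ) ^ 2)⁻¹) ^ r ≤ ((L ^ 0 : ℕ) : ℝ) := by
    rw [one_pow, inv_one, Real.log_one, pow_zero, Nat.cast_one]
    rcases Nat.eq_zero_or_pos r with rfl | hr
    · rw [pow_zero]
    · rw [zero_pow hr.ne']; exact zero_le_one
  have h : ∃ s : ℕ, (Real.log ((1 : ℝ) ^ 2)⁻¹) ^ r ≤ ((L ^ s : ℕ) : ℝ) := ⟨0, h0⟩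
  rw [dif_pos h, (Nat.find_eq_zero h).mpr h0, pow_zero]

/-- The origin `π(0)` lies in the cube `π([0, s−1]ᵈ)` of index `0` (`s ≥ 1`). [cite: Balaban1988Convergent, (2.1) p.254 (bookkeeping)] -/
theorem cover_zero_mem_cubeEnl_zero {s : ℕ} (hs : 1 ≤ s) : cover P 0 ∈ cubeEnl P s 0 0 := by
  refine ⟨0, fun i => ?_, rfl⟩
  have hs' : (1 : ℤ) ≤ s := by exact_mod_cast hs
  simp only [Pi.zero_apply, mul_zero, Nat.zero_mul, Nat.cast_zero, sub_zero, add_zero, zero_add]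
  exact ⟨le_rfl, by linarith⟩

/-- **A lattice point with a coordinate `−1` is OUTSIDE the cube `π([0, s−1]ᵈ)`** whenever the cube side is less than the period `2L^{m+K}`: a deck
translate `z + 2L^{m+K}·v` of a box point `z` (`0 ≤ z_i ≤ s − 1`) never has a coordinate `−1`. [cite: Balaban1987RG1, (0.1) p.251 (bookkeeping)] -/
theorem cover_notMem_cubeEnl_zero {s : ℕ} (hsS : s < P.sitesPerDir 0) (w : Pt P.d) {i : Fin P.d} (hw : w i = -1) :
    cover P w ∉ cubeEnl P s 0 0 := by
  rintro ⟨z, hz, hzw⟩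
  obtain ⟨v, hv⟩ := (cover_eq_cover_iff z w).1 hzw
  have hzi := hz i
  simp only [Pi.zero_apply, mul_zero, Nat.zero_mul, Nat.cast_zero, sub_zero, add_zero, zero_add] at hzi
  have hvi : w i = z i + (P.sitesPerDir 0 : ℤ) * v i := by
    have := congrFun hv i
    simpa [pmul, per] using this
  rw [hw] at hvi
  have hS : (s : ℤ) < (P.sitesPerDir 0 : ℤ) := by exact_mod_cast hsS
  have hS0 : (0 : ℤ) ≤ (P.sitesPerDir 0 : ℤ) := by positivity
  set T : ℤ := (P.sitesPerDir 0 : ℤ) * v i with hT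
  rcases lt_trichotomy (v i) 0 with hv0 | hv0 | hv0
  · have hle : v i ≤ -1 := by omega
    have : T ≤ (P.sitesPerDir 0 : ℤ) * (-1) := by rw [hT]; exact mul_le_mul_of_nonneg_left hle hS0
    linarith [hzi.1]
  · rw [hv0, mul_zero] at hT
    linarith [hzi.1]
  · have hle : 1 ≤ v i := by omega
    have : (P.sitesPerDir 0 : ℤ) * 1 ≤ T := by rw [hT]; exact mul_le_mul_of_nonneg_left hle hS0
    linarith [hzi.2]

/-- **THE CORNER PLAQUETTE** (`d ≥ 2`, cube side `1 ≤ s <` period): the plaquette with source `π(−1,−1,0,…,0)` in the directions `0 < 1` MEETS the cube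
`π([0, s−1]ᵈ)` — its far corner is `π(0)` — while its source and its two near corners lie OUTSIDE it; hence all four of its bonds have their source outside.
[cite: Balaban1985RegularSpaces, p.77 (the plaquette convention); Balaban1988Convergent, (2.2) p.255 (bookkeeping)] -/
theorem exists_corner_plaq (hd : 2 ≤ P.d) {s : ℕ} (hs : 1 ≤ s) (hsS : s < P.sitesPerDir 0) :
    ∃ p : Plaq P 0, p ∈ B8Eq17ClassAkV1.plaqsOf (cubeEnl P s 0 0) ∧ p.src ∉ cubeEnl P s 0 0 ∧
      p.src.shift p.μ ∉ cubeEnl P s 0 0 ∧ p.src.shift p.ν ∉ cubeEnl P s 0 0 := by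
  set μ : Fin P.d := ⟨0, by omega⟩ with hμ
  set ν : Fin P.d := ⟨1, by omega⟩ with hν
  have hne : μ ≠ ν := by
    intro h; have := congrArg Fin.val h; simp [hμ, hν] at this
  have hμν : μ < ν := Fin.mk_lt_mk.2 (by norm_num)
  set w : Pt P.d := fun i => if i = μ ∨ i = ν then -1 else 0 with hw
  have hwμ : w μ = -1 := by simp [hw]
  have hwν : w ν = -1 := by simp [hw]
  refine ⟨⟨cover P w, μ, ν, hμν⟩, ?_, ?_, ?_, ?_⟩
  · rw [B8Eq17ClassAkV1.mem_plaqsOf]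
    refine Or.inr (Or.inr (Or.inr ?_))
    show ((cover P w).shift μ).shift ν ∈ _
    rw [shift_cover, shift_cover]
    have h0 : Function.update (Function.update w μ (w μ + 1)) ν (Function.update w μ (w μ + 1) ν + 1) = 0 := by
      funext i
      by_cases hiν : i = ν
      · subst hiν
        rw [Function.update_self, Function.update_of_ne hne.symm, hwν]; norm_num
      · rw [Function.update_of_ne hiν]
        by_cases hiμ : i = μ
        · subst hiμ; rw [Function.update_self, hwμ]; norm_num
        · rw [Function.update_of_ne hiμ]; simp [hw, hiμ, hiν]
    rw [h0]
    exact cover_zero_mem_cubeEnl_zero hs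
  · exact cover_notMem_cubeEnl_zero hsS w hwμ
  · show (cover P w).shift μ ∉ _
    rw [shift_cover]
    exact cover_notMem_cubeEnl_zero hsS _ (i := ν) (by rw [Function.update_of_ne hne.symm, hwν])
  · show (cover P w).shift ν ∉ _
    rw [shift_cover]
    exact cover_notMem_cubeEnl_zero hsS _ (i := μ) (by rw [Function.update_of_ne hne, hwμ])

end Geometry

/-! ## §2  The index `k = 1`, `Ω₁ = Λ₁ =` one cube; the four pinned bonds -/
section Index

variable (F : T4Family)

/-- The torus of every approximation is longer than one block: `L < 2L^{m+K}`. [cite: Balaban1987RG1, (0.1) p.251 (bookkeeping)] -/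
theorem lt_sitesPerDir_zero (K : ℕ) : F.L < (F.P K).sitesPerDir 0 := by
  have hL : 1 ≤ F.L := F.hL.2.le
  have h1 : F.L ≤ F.L ^ (F.m + K) := (pow_one _).symm.trans_le (Nat.pow_le_pow_right hL (by have := F.hm; omega))
  show F.L < 2 * (F.P K).L ^ ((F.P K).m + (F.P K).K - 0)
  rw [T4Family.P_L, T4Family.P_m, T4Family.P_K, Nat.sub_zero]
  omega

/-- **THE INDEX OF THE WITNESS**: along the flat history `g ≡ 1` with `M = 1` (cube side `L¹·1·R₁ = L`), the length-1 sequence `Ω₁ = Λ₁ =` the cube of index `0`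
is a (2.18) index of record, and node00-def-P11's separation predicate holds for it (it constrains `1 ≤ n < k = 1`: nothing).
[cite: Balaban1988Convergent, (2.1) p.254, (2.18) p.257; Balaban1985RegularSpaces, (1.3)–(1.6) p.77 (bookkeeping)] -/
theorem exists_seq_singleCube (ν : Stage7Numerics) (K : ℕ) :
    ∃ s : SeqOfRecord F ν 1 (fun _ => (1 : ℝ)) K 1, s.Ω 1 = cubeEnl (F.P K) F.L 0 0 ∧ Sect2.SeqSeparated ν.M₁ s := by
  set X : Set (Site (F.P K) 0) := cubeEnl (F.P K) F.L 0 0 with hXdef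
  have hside : dCubeSide (F.P K).L 1 (RkOfRecord (F.P K).L ν.r ((fun _ : ℕ => (1 : ℝ)) 1)) 1 = F.L := by
    simp [dCubeSide, RkOfRecord_at_one]
  have hL : 1 ≤ F.L := F.hL.2.le
  have hX : X ∈ DOfRecord F ν 1 (fun _ => (1 : ℝ)) K 1 := by
    show X ∈ unionsOfCubes (F.P K) (dCubeSide (F.P K).L 1 (RkOfRecord (F.P K).L ν.r ((fun _ : ℕ => (1 : ℝ)) 1)) 1)
    rw [hside, mem_unionsOfCubes_iff]
    refine ⟨{0}, ?_, ?_⟩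
    · rw [Finset.singleton_subset_iff, cubeIndices, Fintype.mem_piFinset]
      intro i
      refine Finset.mem_image.2 ⟨0, Finset.mem_range.2 (Nat.div_pos ?_ (by omega)), by simp⟩
      have := (F.P K).sitesPerDir_ne_zero 0
      omega
    · rw [Finset.set_biUnion_singleton]
  refine ⟨⟨fun j => if j = 1 then X else ∅, fun j => if j = 1 then X else ∅, ⟨?_, ?_, ?_, ?_⟩, ?_, ?_⟩, by simp [hXdef], ?_⟩
  · intro j h1 hj; obtain rfl : j = 1 := le_antisymm hj h1; simpa using hX
  · intro j h1 hj; obtain rfl : j = 1 := le_antisymm hj h1; simpa using hX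
  · intro j _ _; exact subset_rfl
  · intro j h1 hj; omega
  · intro j hj; have : j ≠ 1 := fun h => hj ⟨h ▸ le_rfl, h ▸ le_rfl⟩; simp [this]
  · intro j hj; have : j ≠ 1 := fun h => hj ⟨h ▸ le_rfl, h ▸ le_rfl⟩; simp [this]
  · intro n h1 hn; omega

variable {F}

/-- **THE FOUR PINNED BONDS**: if `U₀` satisfies the constraint `M_𝐁(U₀) = W` on the determining set of `{Ω_j}` (`k ≥ 1`, so `Γ₀ = Ω₁ᶜ`), then on a plaquette
whose source and two near corners lie outside `Ω₁` its plaquette variable IS the scale-0 datum's (`M⁰ = id`; the four bonds meet `Γ₀` at their sources).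
[cite: Balaban1988Convergent, (2.2) p.255, (2.10)–(2.12) p.256 (bookkeeping)] -/
theorem plaqHol_eq_of_agreeOn {P : Params} {G : Type*} [GaugeGroup G] (av : ∀ j, Averaging P j G) {Ω : ℕ → Set (Site P 0)} {k : ℕ}
    (hk : 0 < k) {W : MSField P G} {U₀ : GaugeField P 0 G} (h : AgreeOn (genSet Ω k) (avgFamily av U₀) W) (p : Plaq P 0)
    (h1 : p.src ∉ Ω 1) (h2 : p.src.shift p.μ ∉ Ω 1) (h3 : p.src.shift p.ν ∉ Ω 1) :
    GaugeField.plaqHol U₀ p = GaugeField.plaqHol (W 0) p := by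
  have hb : ∀ b : PBond P 0, b.src ∉ Ω 1 → U₀ b = W 0 b := by
    intro b hb
    have hmem : b ∈ bondsOf (genSet Ω k 0) := by
      left
      show b.src ∈ pts 0 (gammaRegion Ω k 0)
      rw [gammaRegion_zero Ω hk, pts_zero]
      exact hb
    exact h 0 b hmem
  simp only [GaugeField.plaqHol]
  rw [hb ⟨p.src, p.μ⟩ h1, hb ⟨p.src.shift p.μ, p.ν⟩ h2, hb ⟨p.src.shift p.ν, p.μ⟩ h3, hb ⟨p.src, p.ν⟩ h1]

end Index

/-! ## §3  The corner forces `t < B₃·δ₁·η₁²` on any per-scale class-bound statement of [15]-Thm-1 shape -/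
section Corner

variable {F : T4Family} {N : ℕ} [NeZero N]

/-- **★ THE CORNER OBSTRUCTION.**  For `N ≥ 2`, any `ν`, `K`, any thresholds `δ` with `4t < δ₀` (`0 ≤ t ≤ 2`) and `0 < δ₁`, any class radius `ε₀` and any `B₃`:
there are a SEPARATED index `s` (`k = 1`, `Ω₁ = Λ₁ =` one cube) and data `W` (`W₀` = the one-bond configuration at `dist1 = t` around the corner plaquette,
`W₁ = 1`), `δ_n`-small on the determining set, such that «(∃ a minimiser `U₀` in the `ε₀`-class) ∧ (every such minimiser is `B₃δ_nη_n²`-small on `omegaPlaqs`)»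
— the common conclusion of `VariationalThm1Scaled` ∕ `VariationalThm1ScaledSep` — implies `t < B₃·δ₁·η₁²`: the minimiser the first conjunct provides has the
corner plaquette PINNED to `W₀`'s, of size `t`, and the second conjunct bounds it at scale `1`.
[cite: Balaban1985Variational, Thm 1 (7)–(8) p.279; Balaban1988Convergent, (2.2) p.255, (2.10)–(2.12) p.256; Balaban1985RegularSpaces, (1.7) p.77 (bookkeeping)] -/
theorem corner_forces (hN : 2 ≤ N) (ν : Stage7Numerics) (K : ℕ) {δ : ℕ → ℝ} {t : ℝ} (ht0 : 0 ≤ t) (ht2 : t ≤ 2) (hδ0 : 4 * t < δ 0)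
    (hδ1 : 0 < δ 1) (ε₀ B₃ : ℝ) :
    ∃ (s : SeqOfRecord F ν 1 (fun _ => (1 : ℝ)) K 1) (W : MSField (F.P K) (SU N)), Sect2.SeqSeparated ν.M₁ s ∧
      (∀ n, n ≤ 1 → PlaqSmallOn (B8Eq17ClassAkV1.plaqsOf (genSet s.Ω 1 n)) (δ n) (W n)) ∧
      (((∃ U₀, IsMinimizer (avOfRecord F N K) {U | ∀ n, n ≤ 1 → PlaqSmallOn (omegaPlaqs s.Ω n) (ε₀ * (F.P K).eta n ^ 2) U} (genSet s.Ω 1) W U₀) ∧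
        ∀ U₀, IsMinimizer (avOfRecord F N K) {U | ∀ n, n ≤ 1 → PlaqSmallOn (omegaPlaqs s.Ω n) (ε₀ * (F.P K).eta n ^ 2) U} (genSet s.Ω 1) W U₀ →
          ∀ n, n ≤ 1 → PlaqSmallOn (omegaPlaqs s.Ω n) (B₃ * δ n * (F.P K).eta n ^ 2) U₀) →
        t < B₃ * δ 1 * (F.P K).eta 1 ^ 2) := by
  obtain ⟨s, hsΩ, hsep⟩ := exists_seq_singleCube F ν K
  obtain ⟨p, hpX, h1, h2, h3⟩ :=
    exists_corner_plaq (P := F.P K) (by rw [T4Family.P_d]; norm_num) F.hL.2.le (lt_sitesPerDir_zero F K)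
  obtain ⟨D, hDle, hDge⟩ := exists_su_conj_norm_sub_one_ge (N := N) hN ht0 ht2
  have hDt : dist1 D = t := by
    refine le_antisymm hDle ?_
    have h := hDge 1
    simp only [Units.val_one, inv_one, one_mul, mul_one] at h
    show t ≤ ‖(D : MatA N) - 1‖
    exact h
  obtain ⟨W0, hW0p, hW0q⟩ := exists_oneBond_cfg (one_lt_sitesPerDir_zero (F.P K)) D p
  let W : MSField (F.P K) (SU N) := fun j => match j with
    | 0 => W0
    | _ + 1 => fun _ => 1
  refine ⟨s, W, hsep, ?_, ?_⟩
  · intro n hn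
    rcases Nat.le_one_iff_eq_zero_or_eq_one.mp hn with rfl | rfl
    · intro q _
      show dist1 (GaugeField.plaqHol W0 q) < δ 0
      have := hW0q q
      rw [hDt] at this
      linarith
    · intro q _
      show dist1 (GaugeField.plaqHol (fun _ => (1 : SU N) : GaugeField (F.P K) 1 (SU N)) q) < δ 1
      simp only [GaugeField.plaqHol, inv_one, mul_one, GaugeGroup.dist1_one]
      exact hδ1
  · rintro ⟨⟨U₀, hU₀⟩, hall⟩
    have hp1 : p ∈ omegaPlaqs s.Ω 1 := by
      rw [omegaPlaqs_of_ne_zero s.Ω one_ne_zero, hsΩ]; exact hpX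
    have hbound := hall U₀ hU₀ 1 le_rfl p hp1
    have hpin : GaugeField.plaqHol U₀ p = GaugeField.plaqHol (W 0) p :=
      plaqHol_eq_of_agreeOn (avOfRecord F N K) one_pos hU₀.2.1 p (by rw [hsΩ]; exact h1) (by rw [hsΩ]; exact h2)
        (by rw [hsΩ]; exact h3)
    have hW0 : GaugeField.plaqHol (W 0) p = D := hW0p
    rw [hpin, hW0, hDt] at hbound
    exact hbound

/-- `η₁² = 1∕L²` on every torus of the family. [cite: Balaban1987RG1, (0.1) p.251 (bookkeeping)] -/
theorem eta_one_sq (K : ℕ) : (F.P K).eta 1 ^ 2 = ((F.L : ℝ) ^ 2)⁻¹ := by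
  simp [Params.eta, T4Family.P_L, inv_pow]

/-- `0 ≤ η₁² ≤ 1`. [cite: Balaban1987RG1, (0.1) p.251 (bookkeeping)] -/
theorem eta_one_sq_le_one (K : ℕ) : 0 ≤ (F.P K).eta 1 ^ 2 ∧ (F.P K).eta 1 ^ 2 ≤ 1 := by
  rw [eta_one_sq]
  have hL1 : (1 : ℝ) ≤ F.L := by exact_mod_cast F.hL.2.le
  exact ⟨by positivity, inv_le_one_of_one_le₀ (one_le_pow₀ hL1)⟩

end Corner

/-! ## §4  `¬ VariationalThm1Scaled` for every `B₃`; the floor `B₃ ≥ L²∕2` under `VariationalThm1ScaledSep` -/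
section Refutation

variable {F : T4Family} {N : ℕ} [NeZero N]

/-- **★★ node00-def-P11's NAMED FACT `VariationalThm1Scaled F N B₃ a₀ a₁` IS FALSE FOR EVERY `B₃`** (`N ≥ 2`, `0 < a₀`, `0 < a₁`, every four-torus family):
thresholds `δ₀ := min (min a₁ 1) (a₀∕max(B₃,1))`, `δ₁ := min δ₀ (δ₀∕(8·max(B₃,1)))`, class radius `ε₀ := a₀`, corner datum at `t := δ₀∕8` — admissible for
the fact, and `B₃·δ₁·η₁² ≤ t` contradicts §3. [cite: Balaban1985Variational, Thm 1 (7)–(8) p.279; Balaban1988Convergent, (2.2) p.255, (2.12) p.256 (bookkeeping)] -/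
theorem not_variationalThm1Scaled (hN : 2 ≤ N) {a₀ a₁ : ℝ} (ha₀ : 0 < a₀) (ha₁ : 0 < a₁) (B₃ : ℝ) :
    ¬ VariationalThm1Scaled F N B₃ a₀ a₁ := by
  intro h
  set Bm : ℝ := max B₃ 1 with hBm
  have hBm1 : 1 ≤ Bm := le_max_right _ _
  have hBmpos : 0 < Bm := by linarith
  have hBle : B₃ ≤ Bm := le_max_left _ _
  set δ₀ : ℝ := min (min a₁ 1) (a₀ / Bm) with hδ₀
  have hδ₀pos : 0 < δ₀ := lt_min (lt_min ha₁ one_pos) (div_pos ha₀ hBmpos)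
  have hδ₀a₁ : δ₀ ≤ a₁ := (min_le_left _ _).trans (min_le_left _ _)
  have hδ₀one : δ₀ ≤ 1 := (min_le_left _ _).trans (min_le_right _ _)
  have hδ₀a₀ : Bm * δ₀ ≤ a₀ := (mul_le_mul_of_nonneg_left (min_le_right _ _) hBmpos.le).trans_eq (by field_simp)
  set δ₁ : ℝ := min δ₀ (δ₀ / (8 * Bm)) with hδ₁
  have hδ₁pos : 0 < δ₁ := lt_min hδ₀pos (by positivity)
  have hδ₁le : δ₁ ≤ δ₀ := min_le_left _ _
  have hδ₁B : Bm * δ₁ ≤ δ₀ / 8 := (mul_le_mul_of_nonneg_left (min_le_right _ _) hBmpos.le).trans_eq (by field_simp)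
  set t : ℝ := δ₀ / 8 with ht
  obtain ⟨s, W, -, hW, hforce⟩ := corner_forces (F := F) hN numerics7OfRecord₁₂ 1 (δ := fun n => if n = 0 then δ₀ else δ₁) (t := t)
    (by positivity) (by rw [ht]; linarith) (by show 4 * t < δ₀; rw [ht]; linarith) (by show 0 < δ₁; exact hδ₁pos) a₀ B₃
  have hδ : ∀ n, n ≤ 1 → 0 < (fun n => if n = 0 then δ₀ else δ₁) n ∧ (fun n => if n = 0 then δ₀ else δ₁) n ≤ a₁ ∧
      B₃ * (fun n => if n = 0 then δ₀ else δ₁) n ≤ a₀ := by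
    intro n hn
    rcases Nat.le_one_iff_eq_zero_or_eq_one.mp hn with rfl | rfl
    · show 0 < δ₀ ∧ δ₀ ≤ a₁ ∧ B₃ * δ₀ ≤ a₀
      exact ⟨hδ₀pos, hδ₀a₁, by nlinarith [mul_le_mul_of_nonneg_right hBle hδ₀pos.le]⟩
    · show 0 < δ₁ ∧ δ₁ ≤ a₁ ∧ B₃ * δ₁ ≤ a₀
      exact ⟨hδ₁pos, hδ₁le.trans hδ₀a₁,
        by nlinarith [mul_le_mul_of_nonneg_right hBle hδ₁pos.le, mul_le_mul_of_nonneg_left hδ₁le hBmpos.le]⟩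
  have hlt := hforce (h numerics7OfRecord₁₂ 1 (fun _ => (1 : ℝ)) 1 1 s a₀ _ hδ le_rfl W hW)
  change t < B₃ * δ₁ * (F.P 1).eta 1 ^ 2 at hlt
  obtain ⟨hη0, hη1⟩ := eta_one_sq_le_one (F := F) 1
  have hrhs : B₃ * δ₁ * (F.P 1).eta 1 ^ 2 ≤ t := by
    rcases le_or_gt B₃ 0 with hB | hB
    · have : B₃ * δ₁ * (F.P 1).eta 1 ^ 2 ≤ 0 := by
        have h1 : B₃ * δ₁ ≤ 0 := mul_nonpos_iff.2 (Or.inr ⟨hB, hδ₁pos.le⟩)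
        nlinarith
      linarith [show (0 : ℝ) < t by positivity]
    · calc B₃ * δ₁ * (F.P 1).eta 1 ^ 2 ≤ B₃ * δ₁ * 1 := by gcongr
        _ ≤ Bm * δ₁ := by nlinarith [mul_le_mul_of_nonneg_right hBle hδ₁pos.le]
        _ ≤ t := hδ₁B
  exact absurd hlt (not_lt.2 hrhs)

/-- The named fact holds ONLY at degenerate constants (`a₀ ≤ 0` or `a₁ ≤ 0`, where its threshold hypotheses are unsatisfiable) — never where a consumer's
numerics `0 < cR·ε_n ≤ a₁`, `B₃·cR·ε_n ≤ εreg ≤ a₀` can be met. [cite: Balaban1985Variational, Thm 1 (7)–(8) p.279 (bookkeeping)] -/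
theorem variationalThm1Scaled_degenerate (hN : 2 ≤ N) {B₃ a₀ a₁ : ℝ} (h : VariationalThm1Scaled F N B₃ a₀ a₁) : a₀ ≤ 0 ∨ a₁ ≤ 0 := by
  by_contra hc; rw [not_or, not_le, not_le] at hc; exact not_variationalThm1Scaled hN hc.1 hc.2 B₃ h

/-- **★ THE FAITHFUL FACT FORCES `B₃ ≥ L²∕2`** (`N ≥ 2`, `0 < a₀`, `0 < a₁`): comparable thresholds `δ₁ := δ₀∕2`, separation vacuous at `k = 1`, corner datum at
`t := max(B₃,0)·δ₀∕(2L²)` (`δ₀`-small exactly when `B₃ < L²∕2`) — §3's `t < B₃·δ₁·η₁² = B₃·δ₀∕(2L²)` is absurd there.  Print's `B₃(d, L)` may exceed the floor; a unit numeral may not.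
[cite: Balaban1985Variational, Thm 1 (7)–(8) p.279; Balaban1985RegularSpaces, (1.3)–(1.7) p.77; Balaban1988Convergent, (2.2) p.255, (2.12) p.256 (bookkeeping)] -/
theorem half_sq_L_le_of_variationalThm1ScaledSep (hN : 2 ≤ N) {B₃ a₀ a₁ : ℝ} (ha₀ : 0 < a₀) (ha₁ : 0 < a₁)
    (h : VariationalThm1ScaledSep F N B₃ a₀ a₁) : (F.L : ℝ) ^ 2 / 2 ≤ B₃ := by
  by_contra hlt; rw [not_le] at hlt
  have hL1 : (1 : ℝ) ≤ F.L := by exact_mod_cast F.hL.2.le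
  have hL0 : (F.L : ℝ) ≠ 0 := by positivity
  have hL2 : (0 : ℝ) < (F.L : ℝ) ^ 2 := by positivity
  set Bm : ℝ := max B₃ 1 with hBm
  have hBm1 : 1 ≤ Bm := le_max_right _ _
  have hBmpos : 0 < Bm := by linarith
  have hBle : B₃ ≤ Bm := le_max_left _ _
  set Bp : ℝ := max B₃ 0 with hBp
  have hBp0 : 0 ≤ Bp := le_max_right _ _
  have hBpL : Bp < (F.L : ℝ) ^ 2 / 2 := max_lt hlt (by positivity)
  have hBpBm : Bp ≤ Bm := max_le_max le_rfl zero_le_one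
  set δ₀ : ℝ := min (min a₁ 1) (a₀ / Bm) with hδ₀
  have hδ₀pos : 0 < δ₀ := lt_min (lt_min ha₁ one_pos) (div_pos ha₀ hBmpos)
  have hδ₀a₁ : δ₀ ≤ a₁ := (min_le_left _ _).trans (min_le_left _ _)
  have hδ₀one : δ₀ ≤ 1 := (min_le_left _ _).trans (min_le_right _ _)
  have hδ₀a₀ : Bm * δ₀ ≤ a₀ := (mul_le_mul_of_nonneg_left (min_le_right _ _) hBmpos.le).trans_eq (by field_simp)
  set δ₁ : ℝ := δ₀ / 2 with hδ₁
  have hδ₁pos : 0 < δ₁ := by positivity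
  have hδ₁le : δ₁ ≤ δ₀ := by rw [hδ₁]; linarith
  set t : ℝ := Bp * δ₀ / (2 * (F.L : ℝ) ^ 2) with ht
  have ht0 : 0 ≤ t := by positivity
  have h4t : 4 * t < δ₀ := by
    have h4 : 4 * t = (2 * Bp / (F.L : ℝ) ^ 2) * δ₀ := by rw [ht]; field_simp; ring
    have hc : 2 * Bp / (F.L : ℝ) ^ 2 < 1 := by rw [div_lt_one hL2]; linarith
    calc 4 * t = (2 * Bp / (F.L : ℝ) ^ 2) * δ₀ := h4
      _ < 1 * δ₀ := mul_lt_mul_of_pos_right hc hδ₀pos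
      _ = δ₀ := one_mul _
  have ht2 : t ≤ 2 := by linarith
  obtain ⟨s, W, hsep, hW, hforce⟩ := corner_forces (F := F) hN numerics7OfRecord₁₂ 1 (δ := fun n => if n = 0 then δ₀ else δ₁) (t := t)
    ht0 ht2 (by show 4 * t < δ₀; exact h4t) (by show 0 < δ₁; exact hδ₁pos) a₀ B₃
  have hδ : ∀ n, n ≤ 1 → 0 < (fun n => if n = 0 then δ₀ else δ₁) n ∧ (fun n => if n = 0 then δ₀ else δ₁) n ≤ a₁ ∧
      B₃ * (fun n => if n = 0 then δ₀ else δ₁) n ≤ a₀ := by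
    intro n hn
    rcases Nat.le_one_iff_eq_zero_or_eq_one.mp hn with rfl | rfl
    · show 0 < δ₀ ∧ δ₀ ≤ a₁ ∧ B₃ * δ₀ ≤ a₀
      exact ⟨hδ₀pos, hδ₀a₁, by nlinarith [mul_le_mul_of_nonneg_right hBle hδ₀pos.le]⟩
    · show 0 < δ₁ ∧ δ₁ ≤ a₁ ∧ B₃ * δ₁ ≤ a₀
      exact ⟨hδ₁pos, hδ₁le.trans hδ₀a₁,
        by nlinarith [mul_le_mul_of_nonneg_right hBle hδ₁pos.le, mul_le_mul_of_nonneg_left hδ₁le hBmpos.le]⟩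
  have hcomp : ∀ n, n < 1 → (fun n => if n = 0 then δ₀ else δ₁) n ≤ 2 * (fun n => if n = 0 then δ₀ else δ₁) (n + 1) := by
    intro n hn
    obtain rfl : n = 0 := by omega
    show δ₀ ≤ 2 * δ₁
    rw [hδ₁]; linarith
  have hlt' := hforce (h numerics7OfRecord₁₂ 1 (fun _ => (1 : ℝ)) 1 1 s hsep a₀ _ hδ hcomp le_rfl W hW)
  change t < B₃ * δ₁ * (F.P 1).eta 1 ^ 2 at hlt'
  rw [eta_one_sq (F := F) 1] at hlt'
  have hrhs : B₃ * δ₁ * ((F.L : ℝ) ^ 2)⁻¹ ≤ t := by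
    have hB : B₃ ≤ Bp := le_max_left _ _
    have h1 : B₃ * δ₁ ≤ Bp * δ₁ := mul_le_mul_of_nonneg_right hB hδ₁pos.le
    have h2 : B₃ * δ₁ * ((F.L : ℝ) ^ 2)⁻¹ ≤ Bp * δ₁ * ((F.L : ℝ) ^ 2)⁻¹ := mul_le_mul_of_nonneg_right h1 (by positivity)
    have h3 : Bp * δ₁ * ((F.L : ℝ) ^ 2)⁻¹ = t := by rw [ht, hδ₁]; field_simp
    linarith [h2, h3.le]
  exact absurd hlt' (not_lt.2 hrhs)

/-- `VariationalThm1ScaledSep` is false at every `B₃ < L²∕2` (`N ≥ 2`, `0 < a₀`, `0 < a₁`). [cite: Balaban1985Variational, Thm 1 (8) p.279 (bookkeeping)] -/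
theorem not_variationalThm1ScaledSep_of_lt (hN : 2 ≤ N) {B₃ a₀ a₁ : ℝ} (ha₀ : 0 < a₀) (ha₁ : 0 < a₁) (hB : B₃ < (F.L : ℝ) ^ 2 / 2) :
    ¬ VariationalThm1ScaledSep F N B₃ a₀ a₁ :=
  fun h => absurd (half_sq_L_le_of_variationalThm1ScaledSep hN ha₀ ha₁ h) (not_le.2 hB)

end Refutation

end Summit.QuantumFields.YangMills.Theorems.K0VariationalThm1ScaledCorner

end
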